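import Summits.HodgeConjecture.HodgeConjecture.Theorems.Ring2AbelianAllAndreHalfInverseRestriction
import Literature.AlgebraicGeometry.HodgeTheory.ComplexGysinRational
import Literature.AlgebraicGeometry.HodgeTheory.RationalClassesRingChange
import Literature.AlgebraicGeometry.HodgeTheory.RationalLattice
import Literature.AlgebraicGeometry.HodgeTheory.SupportedClassesRationalProofs
import Literature.AlgebraicGeometry.HodgeTheory.GysinKernelWeights
import Literature.AlgebraicTopology.SingularHomology.PoincareDualityProofs
import HarnessLib

/-!
# Ring 2 · sub-cell AbelianAll (ALL ABELIAN VARIETIES), André axis, part XLVI-e — THE INVARIANT PROJECTOR IS DEFINED OVER `ℚ`: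
# `ker j_{t*}` is spanned by rational classes, `Hᵏ(X_t; ℚ) = I_{t,ℚ} ⊕ ker_ℚ` (rational Deligne splitting), the invariant projector `P_t`
# and every transport `j_s^* ∘ M₀` carry rational classes to rational classes

HONEST FRAMING (page 1, verbatim): **research route, not a corollary; conditional on HC_CM plus one named
minimal statement.** Cell line: research route conditional on HC_CM; not a corollary; Q11.4-sentence-2
already refuted in dim ≥ 3. Nothing in this file proves a case of the Hodge conjecture or of `B(X)` for a named `X`; `HC_CM`
(`Theses.RankFourFaces.CMAbelianHodge`) does NOT occur; item `Theses.RankFourFaces.CMToAbelian` (stmt-16267) stays OPEN; N104 untouched;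
no node is born (0 `def`, 0 `sorry`, no named fact). Seat `pub-hodge-ring2-ab-andre-2`, gen 38.

## Content (theorems only; standard axioms; fact-free)

Part XLVI-d turned β into «a class of `𝒳 × X_t` restricting to the invariant projector `P_t` has algebraic restrictions to uncountably many
members `X_s × X_t`» and part XLVI-c showed those restrictions are transport classes `Hᵏ(X_t) → Hᵏ(X_s)`, `j_t^* W ↦ j_s^* W`, `ker j_{t*} ↦ 0`.
To read them as HODGE CLASSES of the abelian `2d`-folds `X_s × X_t` (so that the Hodge conjecture for `X_s × X_t` bears on them), the
transport maps must be morphisms of RATIONAL Hodge structures. THIS FILE does the rational half on the tree's carriers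
(`IsRationalClass`, the change of coefficients `ι : H^•(–; ℚ) → H^•(–; ℂ)`):

* §1 **`ker_fiberGysin_le_span_rational`** — `ker (j_{t*} : Hᵏ(X_t) → H^{k+2}(𝒳))` is SPANNED BY RATIONAL CLASSES: `j_{t*} ∘ ι = u · ι ∘ j_{t*,ℚ}`
  for rational orientations (`complexGysin_ringChange_eq_smul_gysinMap`, `u ≠ 0`), a `ℚ`-complement `C` of `ker j_{t*,ℚ}` maps injectively,
  and `ι` carries `ℚ`-independent families to `ℂ`-independent ones (`linearIndependent_ringChange_iff`) — so the part of a kernel vector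
  along `ι(C)` vanishes.
* §2 **`rational_induction`** — THE RATIONAL DELIGNE SPLITTING as an induction principle: a property of classes of `Hᵏ(X_t)` stable under `0`,
  `+`, `ℚ •`, true on the restrictions `j_t^*(ι W)` of rational classes of `𝒳` and on the rational classes of `ker j_{t*}`, holds on EVERY
  rational class of `Hᵏ(X_t)` (rational descent `ringChange_mem_span_image_iff`: a rational vector in the `ℂ`-span of `ι(D)` lies in `ι(D)`).
* §3 **`isRationalClass_invariantProjector`** — every invariant projector `P` (`P j_t^* = j_t^*`, `P|_{ker j_{t*}} = 0`) maps rational classes to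
  rational classes; **`isRationalClass_map_fiberι_halfInverse`** — for every topological half inverse `M₀` (part XLVI-b/d) and EVERY member `s`,
  the transport `j_s^* ∘ M₀ : Hᵏ(X_t) → Hᵏ(X_s)` maps rational classes to rational classes (`j_s^* M₀ j_t^* (ιW) = j_s^* (ιW) = ι(j_s^* W)`).

## Honest status

Linear algebra over `ℚ ⊂ ℂ` on the carriers; the print content is «the Leray/Deligne splitting is defined over `ℚ`» ([DeligneHodgeII1971,
4.1.1]; [VoisinHodgeII2003, 4.3.3]). No case of HC, no `B`; the Hodge-type half and the Hodge-class reading of the transport classes are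
part XLVI-f. EDGE LABELS: all K. References: DeligneHodgeII1971 (Thm. 4.1.1); VoisinHodgeI2002 (§7.1.1, §11.3.3); VoisinHodgeII2003 (§4.3.3);
HatcherAT2002 (§3.1 p. 198, Thm. 3.30); FultonYoungTableaux1997 (App. B (5)).
-/

noncomputable section

set_option linter.dupNamespace false

namespace Summit.HodgeConjecture.HodgeConjecture.Ring2.AbelianAll

open CategoryTheory CategoryTheory.Limits AlgebraicGeometry MonoidalCategory CartesianMonoidalCategory
open Literature.AlgebraicGeometry Literature.AlgebraicGeometry.Motives
open Literature.AlgebraicGeometry.HodgeTheory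
open Literature.AlgebraicTopology.SingularHomology (singularCohomology cupProduct gysinMap poincare_duality
  finite_singularCohomology_of_compact_chartedSpace)
open Summit.HodgeConjecture.HodgeConjecture.Theorems (deg_fiberGysin_aux)

variable {𝒳 S : SchemeOver ℂ} {d : ℕ} {f : 𝒳 ⟶ S} (hf : IsCompactAbelianPencil f d)

/-- `𝐆[hf, s, k]` — `j_{s*}` for the complex orientations (display notation, as in part XL-a). [cite: FultonYoungTableaux1997, Appendix B §B.1 (5)] -/
local notation3 (prettyPrint := false) "𝐆[" hf ", " s ", " k "]" =>
  complexGysin complexOrientationFamily (IsCompactAbelianPencil.isSmoothProjective_fiberOver hf s)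
    (IsCompactAbelianPencil.isSmoothProjective_total hf) (fiberι f s) (deg_fiberGysin_aux k d)

/-- `𝐣[s, k]` — `j_s^*` as a linear map (display notation). [cite: VoisinHodgeI2002, §7.3.2] -/
local notation3 (prettyPrint := false) "𝐣[" s ", " k "]" => (complexBetti.map (fiberι f s) k).hom

/-- `𝛊[Y, k]` — the change of coefficients `Hᵏ(Y(ℂ); ℚ) → Hᵏ(Y(ℂ); ℂ)` (display notation for the tree's `singularCohomology.ringChange`).
[cite: HatcherAT2002, §3.1 p. 198] -/
local notation3 (prettyPrint := false) "𝛊[" Y ", " k "]" => singularCohomology.ringChange (algebraMap ℚ ℂ) (ComplexPoints Y) k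

/-! ## §1 `ker j_{t*}` is spanned by rational classes -/

section Kernel

/-- **`ker j_{t*}` IS SPANNED BY RATIONAL CLASSES.** On a compact pencil of abelian `d`-folds, `t ∈ S(ℂ)`, `k ≤ 2d`: every `x ∈ Hᵏ(X_t(ℂ); ℂ)` with
`j_{t*} x = 0` lies in the `ℂ`-span of the RATIONAL classes killed by `j_{t*}`. Proof: for rational orientations `ν_t`, `ν` of `X_t(ℂ)`, `𝒳(ℂ)`,
`j_{t*} (ι y) = u • ι (j_{t*,ℚ} y)` with `u ≠ 0` (`complexGysin_ringChange_eq_smul_gysinMap`); split `Hᵏ(X_t; ℚ) = ker j_{t*,ℚ} ⊕ C`; rational classes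
span `Hᵏ(X_t; ℂ)`, so `x = x_K + x_C` with `x_K ∈ ℂ·ι(ker)`, `x_C ∈ ℂ·ι(C)`; `j_{t*} x_K = 0`, hence `j_{t*} x_C = 0`; but `j_{t*,ℚ}` is injective on `C` and
`ι` preserves linear independence (`linearIndependent_ringChange_iff`), so `x_C = 0`. [cite: DeligneHodgeII1971, Thm. 4.1.1]
[cite: VoisinHodgeI2002, §7.1.1] [cite: HatcherAT2002, §3.1 p. 198 and §3.3 Thm. 3.30] -/
theorem ker_fiberGysin_le_span_rational (t : ComplexPoints S) {k : ℕ} (hk : k ≤ 2 * d) (x : complexBetti (fiberOver f t) k)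
    (hx : 𝐆[hf, t, k] x = 0) :
    x ∈ Submodule.span ℂ {z : complexBetti (fiberOver f t) k | IsRationalClass z ∧ 𝐆[hf, t, k] z = 0} := by
  classical
  have hX := hf.isSmoothProjective_total
  have hXt := hf.isSmoothProjective_fiberOver t
  -- rational orientations and Poincaré duality over `ℚ` for `𝒳(ℂ)`
  obtain ⟨νt⟩ := ComplexPoints.isOrientableOver ℚ hXt
  obtain ⟨ν⟩ := ComplexPoints.isOrientableOver ℚ hX
  have hν : ν.HasPoincareDuality := by
    letI := hX.chartedSpace
    haveI := ComplexPoints.compactSpace_of_isSmoothProjective hX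
    haveI := ComplexPoints.t2Space_of_isSmoothProjective hX
    exact fun p q h ↦ poincare_duality ν h
  obtain ⟨u, hu0, hu⟩ := complexGysin_ringChange_eq_smul_gysinMap (μ := complexOrientationFamily)
    hasPoincareDuality_complexOrientationFamily hXt hX (fiberι f t) (a := k) (b := k + 2) (q := 2 * d - k) (by omega) (by omega) νt ν hν
  -- finite-dimensionality of `Hᵏ(X_t; ℚ)`
  haveI : Module.Finite ℚ (singularCohomology ℚ ℚ (ComplexPoints (fiberOver f t)) k) := finite_singularCohomology_rat_complexPoints hXt k
  -- the rational Gysin map `Gq` (abstracted) and its comparison with `j_{t*}`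
  obtain ⟨Gq, hGι⟩ : ∃ Gq : singularCohomology ℚ ℚ (ComplexPoints (fiberOver f t)) k →ₗ[ℚ]
      singularCohomology ℚ ℚ (ComplexPoints 𝒳) (k + 2), ∀ y, 𝐆[hf, t, k] (𝛊[fiberOver f t, k] y) = u • 𝛊[𝒳, k + 2] (Gq y) :=
    ⟨gysinMap νt ν (AlgPoints.mapContinuous (L := ℂ) (fiberι f t)) (show k + (2 * d - k) = 2 * d by omega)
      (show k + 2 + (2 * d - k) = 2 * (d + 1) by omega), fun y ↦ hu y⟩
  obtain ⟨Cq, hKC⟩ := (LinearMap.ker Gq).exists_isCompl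
  -- `x` is in the span of the rational classes, which split along `ker Gq ⊕ Cq`
  have hxspan : x ∈ Submodule.span ℂ (Set.range 𝛊[fiberOver f t, k]) := by
    rw [← setOf_isRationalClass_eq_range, span_isRationalClass_eq_top_of_isSmoothProjective_holds d _ hXt k]
    trivial
  have hsplit : Submodule.span ℂ (Set.range 𝛊[fiberOver f t, k]) ≤
      Submodule.span ℂ (𝛊[fiberOver f t, k] '' (LinearMap.ker Gq : Set _)) ⊔ Submodule.span ℂ (𝛊[fiberOver f t, k] '' (Cq : Set _)) := by
    rw [Submodule.span_le]
    rintro _ ⟨y, rfl⟩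
    obtain ⟨yk, yc, hyk, hyc, rfl⟩ := Submodule.codisjoint_iff_exists_add_eq.1 hKC.codisjoint y
    rw [map_add]
    exact Submodule.add_mem_sup (Submodule.subset_span ⟨yk, hyk, rfl⟩) (Submodule.subset_span ⟨yc, hyc, rfl⟩)
  obtain ⟨xk, hxk, xc, hxc, rfl⟩ := Submodule.mem_sup.1 (hsplit hxspan)
  -- `j_{t*}` kills the span of `ι(ker Gq)`
  have hGk : ∀ z ∈ Submodule.span ℂ (𝛊[fiberOver f t, k] '' (LinearMap.ker Gq : Set _)), 𝐆[hf, t, k] z = 0 := by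
    intro z hz
    induction hz using Submodule.span_induction with
    | mem w hw =>
      obtain ⟨y, hy, rfl⟩ := hw
      rw [hGι, show Gq y = 0 from LinearMap.mem_ker.1 hy, map_zero, smul_zero]
    | zero => exact map_zero _
    | add a b _ _ ha hb => rw [map_add, ha, hb, add_zero]
    | smul c a _ ha => rw [map_smul, ha, smul_zero]
  have hxc0 : 𝐆[hf, t, k] xc = 0 := by
    have h := hx
    rwa [map_add, hGk xk hxk, zero_add] at h
  -- `xc = 0`: expand in `ι` of a basis of `Cq` and use independence of `ι (Gq bᵢ)`
  have hxc_zero : xc = 0 := by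
    obtain ⟨n, b⟩ : Σ n, Module.Basis (Fin n) ℚ Cq := ⟨_, Module.finBasis ℚ Cq⟩
    have hCspan : Submodule.span ℂ (𝛊[fiberOver f t, k] '' (Cq : Set _)) =
        Submodule.span ℂ (Set.range fun i ↦ 𝛊[fiberOver f t, k] (b i : singularCohomology ℚ ℚ (ComplexPoints (fiberOver f t)) k)) := by
      have hC : (Cq : Set (singularCohomology ℚ ℚ (ComplexPoints (fiberOver f t)) k)) =
          (Submodule.span ℚ (Set.range fun i ↦ (b i : singularCohomology ℚ ℚ (ComplexPoints (fiberOver f t)) k)) : Set _) := by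
        have hr : (Set.range fun i ↦ (b i : singularCohomology ℚ ℚ (ComplexPoints (fiberOver f t)) k)) = Cq.subtype '' Set.range b := by
          rw [← Set.range_comp]
          rfl
        rw [hr, ← Submodule.map_span, b.span_eq, Submodule.map_top, Submodule.range_subtype]
      have hr' : (Set.range fun i ↦ 𝛊[fiberOver f t, k] (b i : singularCohomology ℚ ℚ (ComplexPoints (fiberOver f t)) k)) =
          𝛊[fiberOver f t, k] '' Set.range fun i ↦ (b i : singularCohomology ℚ ℚ (ComplexPoints (fiberOver f t)) k) := by
        rw [← Set.range_comp]
        rfl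
      rw [hC, span_ringChange_image_span, hr']
    rw [hCspan] at hxc
    obtain ⟨g, rfl⟩ := (Submodule.mem_span_range_iff_exists_fun ℂ).1 hxc
    have hli : LinearIndependent ℂ fun i ↦ 𝛊[𝒳, k + 2] (Gq (b i : singularCohomology ℚ ℚ (ComplexPoints (fiberOver f t)) k)) := by
      rw [linearIndependent_ringChange_iff]
      have hker : LinearMap.ker (Gq ∘ₗ Cq.subtype) = ⊥ := by
        rw [LinearMap.ker_comp]
        exact Submodule.disjoint_iff_comap_eq_bot.1 hKC.symm.disjoint
      have hli_q : LinearIndependent ℚ (⇑(Gq ∘ₗ Cq.subtype) ∘ ⇑b) := b.linearIndependent.map' _ hker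
      exact hli_q
    have h1 : 𝐆[hf, t, k] (∑ i, g i • 𝛊[fiberOver f t, k] (b i : singularCohomology ℚ ℚ (ComplexPoints (fiberOver f t)) k)) =
        u • ∑ i, g i • 𝛊[𝒳, k + 2] (Gq (b i : singularCohomology ℚ ℚ (ComplexPoints (fiberOver f t)) k)) := by
      rw [map_sum, Finset.smul_sum]
      refine Finset.sum_congr rfl fun i _ ↦ ?_
      rw [map_smul, hGι, smul_comm]
    rw [h1] at hxc0
    have hsum := (smul_eq_zero.1 hxc0).resolve_left hu0
    have hg : ∀ i, g i = 0 := fun i ↦ Fintype.linearIndependent_iff.1 hli g hsum i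
    exact Finset.sum_eq_zero fun i _ ↦ by rw [hg i, zero_smul]
  rw [hxc_zero, add_zero]
  refine Submodule.span_mono ?_ hxk
  rintro _ ⟨y, hy, rfl⟩
  exact ⟨isRationalClass_ringChange y, by rw [hGι, show Gq y = 0 from LinearMap.mem_ker.1 hy, map_zero, smul_zero]⟩

end Kernel

/-! ## §2 The rational Deligne splitting, as an induction principle on rational classes -/

section Induction

/-- `j_t^* (ι W) = ι (j_{t,ℚ}^* W)`: restriction commutes with the change of coefficients. [cite: HatcherAT2002, §3.1 p. 198] -/
theorem map_fiberι_ringChange (t : ComplexPoints S) {k : ℕ} (W : singularCohomology ℚ ℚ (ComplexPoints 𝒳) k) :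
    𝐣[t, k] (𝛊[𝒳, k] W) = 𝛊[fiberOver f t, k] (singularCohomology.map ℚ ℚ (AlgPoints.mapContinuous (L := ℂ) (fiberι f t)) k W) := by
  rw [ringChange_map]

/-- **RATIONAL INDUCTION (the Deligne splitting is defined over `ℚ`).** On a compact pencil of abelian `d`-folds, `t ∈ S(ℂ)`, `k ≤ 2d`: let `p` be a
property of classes of `Hᵏ(X_t(ℂ); ℂ)` with `p 0`, stable under `+` and under rational scalars, holding on every restriction `j_t^* (ι W)` of a
RATIONAL class of `𝒳` and on every RATIONAL class killed by `j_{t*}`. Then `p` holds on EVERY rational class of `Hᵏ(X_t)`. Proof: a rational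
`x = ι ξ` lies in `j_t^* Hᵏ(𝒳) ⊕ ker j_{t*}`, both spanned by such classes (rational classes span `Hᵏ(𝒳)`; §1), i.e. in the `ℂ`-span of `ι(D)`
for the `ℚ`-span `D` of their `ι`-preimages; by rational descent (`ringChange_mem_span_image_iff`) `ξ ∈ D`, and `p` is stable under
`ℚ`-combinations. [cite: DeligneHodgeII1971, Thm. 4.1.1] [cite: VoisinHodgeI2002, §7.1.1] [cite: VoisinHodgeII2003, §4.3.3 Thm. 4.24] -/
theorem rational_induction (t : ComplexPoints S) {k : ℕ} (hk : k ≤ 2 * d) {p : complexBetti (fiberOver f t) k → Prop}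
    (hI : ∀ W : singularCohomology ℚ ℚ (ComplexPoints 𝒳) k, p (𝐣[t, k] (𝛊[𝒳, k] W)))
    (hK : ∀ z : complexBetti (fiberOver f t) k, IsRationalClass z → 𝐆[hf, t, k] z = 0 → p z)
    (h0 : p 0) (hadd : ∀ x y, p x → p y → p (x + y)) (hsmul : ∀ (q : ℚ) (x), p x → p ((q : ℂ) • x))
    {x : complexBetti (fiberOver f t) k} (hx : IsRationalClass x) : p x := by
  have hX := hf.isSmoothProjective_total
  have hXt := hf.isSmoothProjective_fiberOver t
  obtain ⟨ξ, rfl⟩ := hx.exists_ringChange_eq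
  -- the generating set and its `ℚ`-span
  set T : Set (singularCohomology ℚ ℚ (ComplexPoints (fiberOver f t)) k) :=
    {y | (∃ W : singularCohomology ℚ ℚ (ComplexPoints 𝒳) k, 𝛊[fiberOver f t, k] y = 𝐣[t, k] (𝛊[𝒳, k] W)) ∨
      𝐆[hf, t, k] (𝛊[fiberOver f t, k] y) = 0} with hT
  set D : Submodule ℚ (singularCohomology ℚ ℚ (ComplexPoints (fiberOver f t)) k) := Submodule.span ℚ T with hD
  -- `ι ξ ∈ ℂ · ι(T)`: decompose along `Hᵏ(X_t) = j_t^* Hᵏ(𝒳) ⊕ ker j_{t*}`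
  have hmem : 𝛊[fiberOver f t, k] ξ ∈ Submodule.span ℂ (𝛊[fiberOver f t, k] '' (D : Set _)) := by
    have hc := isCompl_range_ker_fiberGysin hf t k
    obtain ⟨a, z, ha, hz, hsum⟩ := (Submodule.codisjoint_iff_exists_add_eq.1 hc.codisjoint) (𝛊[fiberOver f t, k] ξ)
    rw [← hsum]
    have hTD : Submodule.span ℂ (𝛊[fiberOver f t, k] '' T) ≤ Submodule.span ℂ (𝛊[fiberOver f t, k] '' (D : Set _)) :=
      Submodule.span_mono (Set.image_mono Submodule.subset_span)
    refine hTD (Submodule.add_mem _ ?_ ?_)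
    · -- the invariant part: `a ∈ j_t^* Hᵏ(𝒳)`, and `Hᵏ(𝒳)` is spanned by rational classes
      clear hsum
      obtain ⟨V, rfl⟩ := ha
      have hV : V ∈ Submodule.span ℂ (Set.range 𝛊[𝒳, k]) := by
        rw [← setOf_isRationalClass_eq_range, span_isRationalClass_eq_top_of_isSmoothProjective_holds (d + 1) _ hX k]
        trivial
      induction hV using Submodule.span_induction with
      | mem w hw =>
        obtain ⟨W, rfl⟩ := hw
        refine Submodule.subset_span ⟨singularCohomology.map ℚ ℚ (AlgPoints.mapContinuous (L := ℂ) (fiberι f t)) k W, ?_, ?_⟩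
        · exact Or.inl ⟨W, (map_fiberι_ringChange t W).symm⟩
        · exact (map_fiberι_ringChange t W).symm
      | zero => rw [map_zero]; exact Submodule.zero_mem _
      | add b c _ _ hb hc' => rw [map_add]; exact Submodule.add_mem _ hb hc'
      | smul r b _ hb => rw [map_smul]; exact Submodule.smul_mem _ r hb
    · -- the co-vanishing part: §1
      refine Submodule.span_mono ?_ (ker_fiberGysin_le_span_rational hf t hk z (LinearMap.mem_ker.1 hz))
      rintro w ⟨hw, hw0⟩
      obtain ⟨y, rfl⟩ := hw.exists_ringChange_eq
      exact ⟨y, Or.inr hw0, rfl⟩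
  -- rational descent
  have hξ : ξ ∈ D := (ringChange_mem_span_image_iff D ξ).1 hmem
  clear hmem hx
  -- induction over the `ℚ`-span
  induction hξ using Submodule.span_induction with
  | mem y hy =>
    rcases hy with ⟨W, hW⟩ | hy0
    · rw [hW]; exact hI W
    · exact hK _ (isRationalClass_ringChange y) hy0
  | zero => rw [map_zero]; exact h0
  | add a b _ _ ha hb => rw [map_add]; exact hadd _ _ ha hb
  | smul q a _ ha => rw [ringChange_ratCast_smul]; exact hsmul q _ ha

end Induction

/-! ## §3 The invariant projector and the transports preserve rational classes -/

section Projector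

/-- **THE INVARIANT PROJECTOR PRESERVES RATIONAL CLASSES.** On a compact pencil of abelian `d`-folds, `t ∈ S(ℂ)`, `k ≤ 2d`: any endomorphism `P` of
`Hᵏ(X_t)` with `P j_t^* = j_t^*` and `P|_{ker j_{t*}} = 0` (the invariant projector, unique by part XL-a) maps rational classes to rational classes
(§2: `P (j_t^* ιW) = j_t^* ιW = ι (j_t^* W)` and `P z = 0` on the rational kernel classes). [cite: DeligneHodgeII1971, Thm. 4.1.1 and Cor. 4.2.8]
[cite: VoisinHodgeI2002, §7.1.1] -/
theorem isRationalClass_invariantProjector (t : ComplexPoints S) {k : ℕ} (hk : k ≤ 2 * d)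
    (P : complexBetti (fiberOver f t) k →ₗ[ℂ] complexBetti (fiberOver f t) k)
    (hP : ∀ W, P (𝐣[t, k] W) = 𝐣[t, k] W) (hP0 : ∀ x, 𝐆[hf, t, k] x = 0 → P x = 0)
    {x : complexBetti (fiberOver f t) k} (hx : IsRationalClass x) : IsRationalClass (P x) := by
  refine rational_induction hf t hk (p := fun y ↦ IsRationalClass (P y)) (fun W ↦ ?_) (fun z _ hz0 ↦ ?_) ?_ (fun a b ha hb ↦ ?_)
    (fun q a ha ↦ ?_) hx
  · rw [hP, map_fiberι_ringChange]
    exact isRationalClass_ringChange _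
  · rw [hP0 z hz0]
    exact IsRationalClass.zero
  · rw [map_zero]
    exact IsRationalClass.zero
  · rw [map_add]
    exact ha.add hb
  · rw [map_smul]
    exact ha.smul q

/-- **EVERY TRANSPORT `j_s^* ∘ M₀` PRESERVES RATIONAL CLASSES.** For a topological half inverse `M₀ : Hᵏ(X_t) → Hᵏ(𝒳)` (`j_t^* M₀ j_t^* = j_t^*`,
`j_t^* M₀ (ker j_{t*}) = 0`; part XLVI-d) and ANY member `s`: `x` rational ⟹ `j_s^* (M₀ x)` rational. (§2 with `j_s^* M₀ j_t^* (ιW) = j_s^* (ιW) = ι(j_s^* W)`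
and `j_s^* M₀ z = 0` for `z ∈ ker j_{t*}` — part XLVI-c `map_fiberι_halfInverse_eq`, i.e. `ker j_t^* = ker j_s^*`.) At `s = t` this is the projector.
[cite: DeligneHodgeII1971, Thm. 4.1.1] [cite: VoisinHodgeI2002, §7.1.1] [cite: Andre1996Motifs, §5.1 (p. 25)] -/
theorem isRationalClass_map_fiberι_halfInverse (t s : ComplexPoints S) {k : ℕ} (hk : k ≤ 2 * d)
    (M₀ : complexBetti (fiberOver f t) k →ₗ[ℂ] complexBetti 𝒳 k) (hM : ∀ W, 𝐣[t, k] (M₀ (𝐣[t, k] W)) = 𝐣[t, k] W)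
    (hM0 : ∀ x, 𝐆[hf, t, k] x = 0 → 𝐣[t, k] (M₀ x) = 0)
    {x : complexBetti (fiberOver f t) k} (hx : IsRationalClass x) : IsRationalClass (𝐣[s, k] (M₀ x)) := by
  obtain ⟨hMs, hM0s⟩ := map_fiberι_halfInverse_eq hf t s M₀ hM hM0
  refine rational_induction hf t hk (p := fun y ↦ IsRationalClass (𝐣[s, k] (M₀ y))) (fun W ↦ ?_) (fun z _ hz0 ↦ ?_) ?_
    (fun a b ha hb ↦ ?_) (fun q a ha ↦ ?_) hx
  · rw [hMs, map_fiberι_ringChange]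
    exact isRationalClass_ringChange _
  · rw [hM0s z hz0]
    exact IsRationalClass.zero
  · rw [map_zero, map_zero]
    exact IsRationalClass.zero
  · rw [map_add, map_add]
    exact ha.add hb
  · rw [map_smul, map_smul]
    exact ha.smul q

end Projector

end Summit.HodgeConjecture.HodgeConjecture.Ring2.AbelianAll

end
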